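import Summits.BirchSwinnertonDyer.BirchSwinnertonDyer.Theorems.ThetaPartnerAtTwoSignedTransportAtTwoResidualNaturality
import Summits.BirchSwinnertonDyer.BirchSwinnertonDyer.Theorems.ThetaPartnerAtTwoSignedTransportAtTwoResidualUpper
import Summits.BirchSwinnertonDyer.BirchSwinnertonDyer.Theorems.ThetaPartnerAtTwoSignedTransportAtTwoResidualArchimedean
import Summits.BirchSwinnertonDyer.BirchSwinnertonDyer.Theorems.ByReductionTypeAtTwoSupersingularThetaHabitatPlusNegDisc
import HarnessLib

/-!
# Stub `stub_sel2U` of line `bridge` v9 of the crux `SignedTransportAtTwo` (stmt-BirchSwinnertonDyer-20333, route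
# `ThetaPartnerAtTwo`) — PROVED: the UPPER containment `R(W) ⊆ R♯(W)` of the residual devissage at `2`
# (lead prover bsd-wall-tp2-p1 g4; `--supports stmt-BirchSwinnertonDyer-20333`, registered stub by name + signature)

HONEST FRAMING. THEOREM ONLY; it proves one of the five registered stubs of the skeleton of record (v9, sha16
b406eeb4d89a6b0e) and nothing else; the crux stays open (stubs `stub_sel2T`, `stub_sel2L`, `stub_lam2d`, `stub_V2mtR`);
BSD is not proved by any of this. No import of any route file.

WHAT. On the theta habitat (`W` non-CM of analytic rank `0`, `A` CM, both good supersingular at `2` with `a₂ = 0`, an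
equivariant `W[2] ≃ A[2]`), for every cyclotomic `κ`, every admissible `S₀` and every residual class
`c ∈ H¹(ℚ_∞, W[2^∞][2])` whose Kummer image `k(c)` lies in Kobayashi's `Sel⁺(W/ℚ_∞)`:
(a) `c` is unramified outside `S₀ ∪ {2}` (file `…ResidualUpper`, Silverman X.4.2 halving at good odd places);
(b) `c` is residually trivial at the real place (file `…ResidualArchimedean`; `Δ_W < 0` by `Δ_neg_of_cmPartner_two`);
(c) `k(c)` satisfies the signed Kummer condition at `2` over `ℚ_∞` w.r.t. `⨆ₙ E⁺(ℚ_{n,2})` (file `…ResidualUpper`).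

References: [GreenbergVatsal2000] p. 3, Prop. (2.8); [BDKim2009] Prop. 2.10; [Kobayashi2003] Def. 1.1; [Matsuno2008] Thm. 4.2.
-/

set_option autoImplicit false
-- D-0017: single-problem summit, so `Summit.BirchSwinnertonDyer.BirchSwinnertonDyer.…` repeats a namespace BY DESIGN.
set_option linter.dupNamespace false

noncomputable section

open scoped Classical AddSubgroup

open WeierstrassCurve NumberField IsDedekindDomain Literature Literature.NumberTheory.EllipticCurves
  Literature.NumberTheory.GaloisRepresentations Literature.NumberTheory.EllipticCurves.GreenbergVatsal2000
  Literature.NumberTheory.EllipticCurves.Kobayashi2003 ZpExtension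
  Literature.NumberTheory.EllipticCurves.Rank1Residual

namespace Summit.BirchSwinnertonDyer.BirchSwinnertonDyer.Theorems.SignedTransportAtTwo

/-! ## The registered stub `stub_sel2U` of line `bridge` v9 -/

section Stub

/-- **stub sel2U** (UPPER containment; GV Prop. (2.8) ⊆-half / Kim Prop. 2.10 READ AT `2`): on the theta habitat, every
residual class `c ∈ H¹(ℚ_∞, W[2^∞][2])` whose Kummer image lies in Kobayashi's `Sel⁺(W/ℚ_∞)` is (a) unramified outside
`S₀ ∪ {2}` (`mem_unramifiedKer_of_pushH1_mem_localKerOver`: halving is unramified at good odd places), (b) residually trivial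
at the real place (`mem_infKer_of_pushH1_mem_localKerOver_of_Δ_neg`, using `Δ_W < 0` forced by the CM partner,
`Δ_neg_of_cmPartner_two`), and (c) satisfies the signed Kummer condition at `2` over `ℚ_∞` with respect to
`⨆ₙ E⁺(ℚ_{n,2})` (`conjH1_mem_localKummerOverOfEmb_iSup_of_mem_signedSelmerInfty`). [cite: GreenbergVatsal2000, p. 3 and Prop. (2.8)]
[cite: BDKim2009, Prop. 2.10] [cite: Kobayashi2003, Def. 1.1] -/
theorem stub_sel2U :
    ∀ (W : WeierstrassCurve ℚ) [W.IsElliptic] [W.IsGloballyMinimal] (A : WeierstrassCurve ℚ) [A.IsElliptic]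
      [A.IsGloballyMinimal], ¬ W.HasCM → W.analyticRank = 0 → GoodSS W 2 → W.frobeniusTrace 2 = 0 →
      A.HasCM → GoodSS A 2 → A.frobeniusTrace 2 = 0 →
    (∃ e : WeierstrassCurve.geomTorsion W (2 : ℤ) ≃+ WeierstrassCurve.geomTorsion A (2 : ℤ),
      ∀ (σ : Field.absoluteGaloisGroup ℚ) (P : WeierstrassCurve.geomTorsion W (2 : ℤ)), e (σ • P) = σ • e P) →
    ∀ (κ : ZpExtension ℚ 2), κ.IsCyclotomic →
    ∀ (S₀ : Finset (HeightOneSpectrum (𝓞 ℚ))), (∀ v ∈ S₀, ((2 : ℕ) : 𝓞 ℚ) ∉ v.asIdeal) →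
      (∀ v : HeightOneSpectrum (𝓞 ℚ), ¬ W.HasGoodReductionAt v → v ∈ S₀) →
      (∀ v : HeightOneSpectrum (𝓞 ℚ), ¬ A.HasGoodReductionAt v → v ∈ S₀) →
    ∀ c : subgroupH1 κ.kerSubgroup ↥((↥(W.geomPrimaryTorsion 2))[(2 : ℤ)]),
      pushH1 κ.kerSubgroup ((↥(W.geomPrimaryTorsion 2))[(2 : ℤ)]).subtype (subtype_torsionBy_smul W 2) c ∈
          signedSelmerInfty W κ 1 →
      c ∈ unramifiedOutside κ.kerSubgroup ↥((↥(W.geomPrimaryTorsion 2))[(2 : ℤ)]) 2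
          (↑S₀ : Set (HeightOneSpectrum (𝓞 ℚ))) ∧
        (∀ (w : InfinitePlace ℚ) (σ : Field.absoluteGaloisGroup ℚ),
          Literature.NumberTheory.EllipticCurves.conjH1 κ.kerSubgroup ↥((↥(W.geomPrimaryTorsion 2))[(2 : ℤ)]) σ c ∈
            GreenbergSelmer.infKer κ.kerSubgroup ↥((↥(W.geomPrimaryTorsion 2))[(2 : ℤ)]) w) ∧
        (∀ (v : HeightOneSpectrum (𝓞 ℚ)), ((2 : ℕ) : 𝓞 ℚ) ∈ v.asIdeal → ∀ σ : Field.absoluteGaloisGroup ℚ,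
          W.conjH1 2 κ.kerSubgroup σ
              (pushH1 κ.kerSubgroup ((↥(W.geomPrimaryTorsion 2))[(2 : ℤ)]).subtype (subtype_torsionBy_smul W 2) c) ∈
            localKummerOverOfEmb W 2 κ.kerSubgroup (closureEmb (K := ℚ) (v.adicCompletion ℚ))
              (⨆ n : ℕ, signedLocalPoints κ (v.adicCompletion ℚ) W 1 n)) := by
  intro W _ _ A _ _ hCM hr hssW ha2W hCMA hssA ha2A he κ hκ S₀ hS2 hSW hSA c hc
  obtain ⟨e, hee⟩ := he
  have hΔ : W.Δ < 0 := ThetaPartnerXRoute.Δ_neg_of_cmPartner_two W A hCMA hssA e hee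
  -- the Kummer image lies in the classical Selmer group over `ℚ_∞`
  have hSel : pushH1 κ.kerSubgroup ((↥(W.geomPrimaryTorsion 2))[(2 : ℤ)]).subtype (subtype_torsionBy_smul W 2) c ∈
      W.selmerInfty κ := signedSelmerInfty_le_selmerInfty W κ 1 hc
  have hSel' := (W.mem_selmerGroupOver_iff 2 κ.kerSubgroup _).mp hSel
  -- conjugation commutes with the Kummer map
  have hconj : ∀ σ : Field.absoluteGaloisGroup ℚ,
      W.conjH1 2 κ.kerSubgroup σ
          (pushH1 κ.kerSubgroup ((↥(W.geomPrimaryTorsion 2))[(2 : ℤ)]).subtype (subtype_torsionBy_smul W 2) c) =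
        pushH1 κ.kerSubgroup ((↥(W.geomPrimaryTorsion 2))[(2 : ℤ)]).subtype (subtype_torsionBy_smul W 2)
          (Literature.NumberTheory.EllipticCurves.conjH1 κ.kerSubgroup ↥((↥(W.geomPrimaryTorsion 2))[(2 : ℤ)]) σ c) :=
    fun σ ↦ (pushH1_conjH1 κ.kerSubgroup ((↥(W.geomPrimaryTorsion 2))[(2 : ℤ)]).subtype
      (subtype_torsionBy_smul W 2) σ c).symm
  refine ⟨?_, ?_, ?_⟩
  · -- (a) unramified outside `S₀ ∪ {2}`
    rw [mem_unramifiedOutside_iff]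
    intro v hvS hv2 σ
    have hgood : W.HasGoodReductionAt v := by
      by_contra h; exact hvS (hSW v h)
    have h := hSel'.1 v σ
    rw [hconj σ] at h
    exact mem_unramifiedKer_of_pushH1_mem_localKerOver W 2 κ.kerSubgroup hgood hv2 _ h
  · -- (b) residually trivial at the real place
    intro w σ
    have h := hSel'.2 w σ
    rw [hconj σ] at h
    exact mem_infKer_of_pushH1_mem_localKerOver_of_Δ_neg W κ.kerSubgroup hΔ w _ h
  · -- (c) the signed Kummer condition at `2` over `ℚ_∞`
    intro v hv σ
    exact conjH1_mem_localKummerOverOfEmb_iSup_of_mem_signedSelmerInfty W κ 1 hc v hv σ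

end Stub

end Summit.BirchSwinnertonDyer.BirchSwinnertonDyer.Theorems.SignedTransportAtTwo

end
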